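import Summits.BirchSwinnertonDyer.BirchSwinnertonDyer.Theorems.PrintCFramBottomClassIndexLawFiveLeRegularLocusBSDp
import Summits.BirchSwinnertonDyer.BirchSwinnertonDyer.Theorems.ClassRecordThreeShimuraKolyvaginOrderBoundAtThreeTransport
import Summits.BirchSwinnertonDyer.Rank1Residual.X11b.AnticyclotomicEmbedding
import Summits.BirchSwinnertonDyer.Rank1Residual.X12.O11.RouteUSevenBinders
import Literature.NumberTheory.EllipticCurves.AnticyclotomicPConverseLinks
import Literature.NumberTheory.EllipticCurves.KrizLi2019.EisensteinHeegnerLog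
import Literature.NumberTheory.EllipticCurves.BSDHeegnerPointsGrossZagierProofs
import Literature.NumberTheory.EllipticCurves.AnalyticRankOrderProofs
import Literature.NumberTheory.NumberFields.CongruenceSubgroupTorsionFree
import HarnessLib

/-!
# Route `PrintCFram`, crux C2 `BottomClassIndexLawFiveLe` (stmt-BirchSwinnertonDyer-20372), line `eisenstein-resource-bdp-line`
# (registry v13/v14): THE KRIZ–LI LOCUS IS `L`-VALUE-FREE — `L(W^{(d_K)}, 1) ≠ 0` FOLLOWS from Kriz–Li 2019 Thm. 1.20,
# Gross–Zagier and modularity; the «Kriz–Li datum» of the composition is equivalent to CHARACTER DATA at a Heegner field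

Cell `bsd-print-cfram`, width seat `bsd-line-cfram-p1-w6` (generation g2); `--supports stmt-BirchSwinnertonDyer-20372` (helper).
THEOREMS ONLY (0 definitions, 0 named facts, 0 `sorry`); tree-only (no literature queries, kit 0).

HONEST FRAMING. The crux C2 is CLASS-WIDE and stays OPEN (its research residue on the line of record is the off-locus pair
`stub_kolyvaginUpper_borelCM_pairSum_offKrizLi` / `stub_flatEisensteinIncl_cmRamified_offKrizLi`). Nothing about BSD is proved
here; no summit statement is proved by this seat; no stub is closed. Everything below is CONDITIONAL on the named facts it
displays (Kriz–Li 2019 Thm. 1.20 `KrizLi2019.thm120_padicLogHeegner_unit_of_bernoulli`, the conjuncts of `ToricPublishedInputs`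
— Gross–Zagier I.(6.3), modularity, Heegner points over `K` —, and for §4 the seven print facts of p630429).

WHAT IS PROVED. In the (KL) branch of the registered composition `EisensteinResourceBdpLine.BottomClassIndexLawFiveLe_of` (v13,
`Lines/eisenstein_resource_bdp_line.lean`) and in LEAD g5's regular-locus theorem
`RegularLocus.ramifiedCMBottomClassIndexLawAtZp_of_regularKrizLiDatum` (p630429) the «Kriz–Li datum» carries the analytic conjunct
`hLt : L(W^{(d_{K''})}, 1) ≠ 0`. It is REDUNDANT: Kriz–Li's conclusion `(|W̃^{ns}(𝔽_p)|/p)·log_{ω_W} P ≢ 0 (mod p)` gives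
`log_{ω_W} P ≠ 0` (`KrizLi2019.padicLogOmega_ne_zero_of_not_norm_le`), hence the Heegner point `P ∈ W(K'')` is NOT torsion
(§1: the `ℤ_p`-linear formal logarithm kills torsion, `AcPConverseLinks.padicLogPoint_formalIndex_smul_eq_zero_of_isOfFinAddOrder`),
hence `L'(W/K'', 1) ≠ 0` (Gross–Zagier, `lDerivEK_ne_zero_iff_not_isOfFinAddOrder`), hence `r_an(W) + r_an(W^{(d)}) ≤ 1`
(product rule, `ShimuraKolyvaginTransport.analyticRank_add_le_one_of_LDerivEK_ne_zero`, modularity), and with `r_an(W) = 1`: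
`r_an(W^{(d)}) = 0`, i.e. `L(W^{(d)}, 1) ≠ 0` (`analyticRank_eq_zero_iff_holds`). This is Kriz–Li's own «In particular, `P ∈ E(K)`
is of infinite order and `E/K` has analytic and algebraic rank 1» (FMS 7 (2019) Thm. 1.20, p. 8) typed against the line's datum.
§3 packages it on the CM-ramified class (`h2` «no split multiplicative prime» is automatic for CM, `p ∣ N_W` from additivity);
§4 restates p630429 WITHOUT `hLt`; §5 proves «Kriz–Li datum ⟺ CHARACTER data `(ψ, ω, ε_K)` with (1), (3), (4) and the
trace form at a Heegner field `K''` with `d_{K''}` odd `< −4`» modulo `ToricPublishedInputs` (the Heegner point and the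
parametrisation datum come from `exists_isHeegnerPoint`), so the off-locus hypothesis `¬ ∃ (Kriz–Li datum)` of the two research
stubs is EQUIVALENT to the purely arithmetic `¬ ∃ (character data)` — no `Dt`, `H`, `ι`, `P` and no `L`-value inside the `¬∃`.
beyond-print theorem: NO (plumbing of printed theorems). BSD is not proved by any of this.

References: [KrizLi2019] D. Kriz, C. Li, *Goldfeld's conjecture and congruences between Heegner points*, Forum Math. Sigma 7
(2019) e15, Thm. 1.20 (pp. 7–8), Rem. 1.21; [GrossZagier1986] Thm. I.(6.3), V.§2; [Gross1991] (1.1), Thm. 1.3;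
[IrelandRosen1990] Prop. 20.5.4; [BCDTJAMS2001] Thm. A; [SilvermanAEC2009] IV.6.4, VII.2.2.
-/

set_option autoImplicit false
-- `…BirchSwinnertonDyer.BirchSwinnertonDyer.Theorems…` is the problem's mandated namespace (D-0017).
set_option linter.dupNamespace false

noncomputable section

open scoped Classical

namespace Summit.BirchSwinnertonDyer.BirchSwinnertonDyer.Theorems.PrintCFram.KrizLiLValueFree

open WeierstrassCurve NumberField IsDedekindDomain Field
  Literature.NumberTheory.EllipticCurves Literature.NumberTheory.EllipticCurves.ModularForms
  Literature.NumberTheory.EllipticCurves.Rank1Residual Literature.NumberTheory.EllipticCurves.Rank1Residual.Typed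
  Literature.NumberTheory.GaloisRepresentations Literature.NumberTheory.GaloisCohomology
  Summit.BirchSwinnertonDyer.BirchSwinnertonDyer.Theses.UniversalToricDescent
  Summit.BirchSwinnertonDyer.Rank1Residual Summit.BirchSwinnertonDyer.Rank1Residual.Additive
  Summit.BirchSwinnertonDyer.Rank1Residual.X11b Summit.BirchSwinnertonDyer.Rank1Residual.X11b.AcSelmer
  Summit.BirchSwinnertonDyer.Rank1Residual.X12
  Summit.BirchSwinnertonDyer.BirchSwinnertonDyer.Theorems
  Summit.BirchSwinnertonDyer.BirchSwinnertonDyer.Theorems.PrintCFram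

/-! ## §1 The `ℤ_p`-linear logarithm kills torsion: `log_{ω_W} P ≠ 0 ⟹ P` has infinite order -/

section Log

variable (W : WeierstrassCurve ℚ) [W.IsElliptic] [W.IsGloballyMinimal] (p : ℕ) [Fact p.Prime]
  {K : Type} [Field K] [NumberField K]

/-- **A torsion point has `log_{ω_W} P = 0`.** `Castella2018.padicLogOmega W p ι P = log_W(z(m₀ • P_ι))/m₀` and the numerator
vanishes on torsion points (`AcPConverseLinks.padicLogPoint_formalIndex_smul_eq_zero_of_isOfFinAddOrder`: the formal logarithm is
additive on `E₁(ℚ_p)` and `log(O) = 0`). [cite: SilvermanAEC2009, IV.6.4 and VII.2.2] [cite: Castella2018, §2.2 (arXiv:1704.06608 p. 5)] -/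
theorem padicLogOmega_eq_zero_of_isOfFinAddOrder (ι : K →+* ℚ_[p]) {P : (W.baseChange K).toAffine.Point}
    (hP : IsOfFinAddOrder P) : Castella2018.padicLogOmega W p ι P = 0 := by
  unfold Castella2018.padicLogOmega
  rw [AcPConverseLinks.padicLogPoint_formalIndex_smul_eq_zero_of_isOfFinAddOrder W p ι hP, zero_div]

/-- **`log_{ω_W} P ≠ 0 ⟹ P` is not torsion** (contrapositive of `padicLogOmega_eq_zero_of_isOfFinAddOrder`). This is the step
«In particular, `P ∈ E(K)` is of infinite order» of Kriz–Li's Thm. 1.20. [cite: KrizLi2019, Thm. 1.20 (p. 8)]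
[cite: SilvermanAEC2009, IV.6.4 and VII.2.2] -/
theorem not_isOfFinAddOrder_of_padicLogOmega_ne_zero (ι : K →+* ℚ_[p]) {P : (W.baseChange K).toAffine.Point}
    (h : Castella2018.padicLogOmega W p ι P ≠ 0) : ¬ IsOfFinAddOrder P :=
  fun hP ↦ h (padicLogOmega_eq_zero_of_isOfFinAddOrder W p ι hP)

end Log

/-! ## §2 Kriz–Li Thm. 1.20 at a Heegner datum: `P` non-torsion, `L'(W/K,1) ≠ 0`, `r_an(W) + r_an(W^{(d_K)}) ≤ 1`, `L(W^{(d_K)},1) ≠ 0` -/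

section Datum

variable {p : ℕ} [Fact p.Prime]

/-- **Kriz–Li Thm. 1.20 ⟹ the Heegner point is NOT torsion** — for `W/ℚ` globally minimal with Kriz–Li's binders at `(W, p)`
(`p` odd; a primitive `ψ` and the Teichmüller `ω` with `W[p]^{ss} ≅ 𝔽_p(ψ) ⊕ 𝔽_p(ψ⁻¹ω)` in trace form `hss`; (1) `h1`, `h1'`;
(2) `h2`; (3) `h3`), a Heegner field `K` of level `N = N_W` with `p ∣ N` (so `p` splits in `K`), a Heegner point `P ∈ W(K)`
(`P ↦ heegnerPointComplex Dt H` along `ι`), the Kronecker character `ε_K` and (4) `h4`: `P` has infinite order. PROOF: read `P` in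
`W(ℚ_p)` along the embedding `X11b.embAt` at a (degree-one) prime `𝔭 ∋ p` of `K`; Kriz–Li gives
`(|W̃^{ns}(𝔽_p)|/p)·log_{ω_W} P ≢ 0`, so `log_{ω_W} P ≠ 0` (`KrizLi2019.padicLogOmega_ne_zero_of_not_norm_le`) and §1 concludes.
CONDITIONAL on the named fact `hKL`. [cite: KrizLi2019, Thm. 1.20 (pp. 7–8) and Rem. 1.21 (p. 8)] -/
theorem not_isOfFinAddOrder_of_thm120 (hKL : KrizLi2019.thm120_padicLogHeegner_unit_of_bernoulli) (hp2 : p ≠ 2)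
    (W : WeierstrassCurve ℚ) [W.IsElliptic] [W.IsGloballyMinimal]
    (h2 : ∀ ℓ : ℕ, (hℓ : ℓ.Prime) → ¬ (haveI := Fact.mk hℓ; W.HasSplitMultiplicativeReductionAtPrime ℓ))
    (N : ℕ) [NeZero N] (K : Type) [Field K] [NumberField K]
    (Dt : ModularParametrizationData W N) (H : HeegnerDatum N (NumberField.discr K)) (ι : K →+* ℂ)
    (P : (W.baseChange K).toAffine.Point) (hN : W.conductorNorm ℤ = N) (hK : IsImaginaryQuadratic K)
    (hHH : SatisfiesHeegnerHypothesis N K) (hpN : p ∣ N)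
    (hP : WeierstrassCurve.Affine.Point.map ι.toRatAlgHom P = heegnerPointComplex Dt H)
    (f : ℕ) [NeZero f] (ψ : DirichletCharacter ℚ_[p] f) (ω : DirichletCharacter ℚ_[p] p)
    (hψ : ψ.IsPrimitive) (hω : KrizLi2019.IsTeichmullerCharacter ω)
    (hss : ∀ ℓ : ℕ, ℓ.Prime → ¬ (ℓ ∣ p * W.conductorNorm ℤ) →
      ‖((W.LFunction ℓ : ℤ) : ℚ_[p]) - (ψ (ℓ : ZMod f) + ψ⁻¹ (ℓ : ZMod f) * ω (ℓ : ZMod p))‖ < 1)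
    (h1 : ψ (p : ZMod f) ≠ 1) (h1' : KrizLi2019.primVal (KrizLi2019.invMulOmega ψ ω) p ≠ 1)
    (h3 : ∀ ℓ : ℕ, (hℓ : ℓ.Prime) → ℓ ≠ p →
      (haveI := Fact.mk hℓ; ¬ W.HasGoodReductionAtPrime ℓ ∧ ¬ W.HasMultiplicativeReductionAtPrime ℓ) →
      ψ (ℓ : ZMod f) ≠ 1 ∧ KrizLi2019.primVal (KrizLi2019.invMulOmega ψ ω) ℓ ≠ 1)
    (εK : DirichletCharacter ℚ_[p] (NumberField.discr K).natAbs) (hεK : KrizLi2019.IsKroneckerCharacterOf K εK)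
    (h4 : ¬ (‖KrizLi2019.bernoulliOnePrim (KrizLi2019.bernoulliCharOne ψ εK) *
        KrizLi2019.bernoulliOnePrim (KrizLi2019.bernoulliCharTwo ψ εK ω)‖ ≤ (p : ℝ)⁻¹)) :
    ¬ IsOfFinAddOrder P := by
  have hp : p.Prime := Fact.out
  obtain ⟨𝔭, h𝔭⟩ := Literature.NumberTheory.NumberFields.RingOfIntegers.exists_heightOneSpectrum_natCast_mem K hp
  obtain ⟨he, hf⟩ := UniversalToricDescentStrictPlace.degreeOne_of_dvd_of_heegner hK hHH hpN h𝔭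
  have hsplit : ((Ideal.span {(p : ℤ)}).primesOver (𝓞 K)).ncard = 2 := hHH p hp hpN
  haveI : NeZero (NumberField.discr K).natAbs := ⟨Int.natAbs_ne_zero.mpr (NumberField.discr_ne_zero K)⟩
  subst hN
  have hne := hKL p hp2 W f ψ ω hψ hω hss h1 h1' h2 h3 Dt K hK hHH hsplit εK hεK H ι (X11b.embAt K p 𝔭 h𝔭 he hf) P hP h4
  exact not_isOfFinAddOrder_of_padicLogOmega_ne_zero W p _ (KrizLi2019.padicLogOmega_ne_zero_of_not_norm_le hne)

/-- **Kriz–Li Thm. 1.20 + Gross–Zagier ⟹ `L'(W/K, 1) ≠ 0`** at a Heegner datum as in `not_isOfFinAddOrder_of_thm120`: the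
Heegner point is not torsion, and «`y_K` has infinite order iff `L'(E/K, 1) ≠ 0`» (`lDerivEK_ne_zero_iff_not_isOfFinAddOrder`,
Gross–Zagier I.(6.3) `hGZ`). CONDITIONAL on `hKL`, `hGZ`. [cite: KrizLi2019, Thm. 1.20 (p. 8)] [cite: Gross1991, (1.1)]
[cite: GrossZagier1986, Thm. I.(6.3) and V.§2] -/
theorem lDerivEK_ne_zero_of_thm120 (hKL : KrizLi2019.thm120_padicLogHeegner_unit_of_bernoulli) (hp2 : p ≠ 2)
    (W : WeierstrassCurve ℚ) [W.IsElliptic] [W.IsGloballyMinimal]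
    (h2 : ∀ ℓ : ℕ, (hℓ : ℓ.Prime) → ¬ (haveI := Fact.mk hℓ; W.HasSplitMultiplicativeReductionAtPrime ℓ))
    (N : ℕ) [NeZero N] (K : Type) [Field K] [NumberField K] (hGZ : gross_zagier N W K)
    (Dt : ModularParametrizationData W N) (H : HeegnerDatum N (NumberField.discr K)) (ι : K →+* ℂ)
    (P : (W.baseChange K).toAffine.Point) (hN : W.conductorNorm ℤ = N) (hK : IsImaginaryQuadratic K)
    (hHH : SatisfiesHeegnerHypothesis N K) (hpN : p ∣ N)
    (hP : WeierstrassCurve.Affine.Point.map ι.toRatAlgHom P = heegnerPointComplex Dt H)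
    (f : ℕ) [NeZero f] (ψ : DirichletCharacter ℚ_[p] f) (ω : DirichletCharacter ℚ_[p] p)
    (hψ : ψ.IsPrimitive) (hω : KrizLi2019.IsTeichmullerCharacter ω)
    (hss : ∀ ℓ : ℕ, ℓ.Prime → ¬ (ℓ ∣ p * W.conductorNorm ℤ) →
      ‖((W.LFunction ℓ : ℤ) : ℚ_[p]) - (ψ (ℓ : ZMod f) + ψ⁻¹ (ℓ : ZMod f) * ω (ℓ : ZMod p))‖ < 1)
    (h1 : ψ (p : ZMod f) ≠ 1) (h1' : KrizLi2019.primVal (KrizLi2019.invMulOmega ψ ω) p ≠ 1)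
    (h3 : ∀ ℓ : ℕ, (hℓ : ℓ.Prime) → ℓ ≠ p →
      (haveI := Fact.mk hℓ; ¬ W.HasGoodReductionAtPrime ℓ ∧ ¬ W.HasMultiplicativeReductionAtPrime ℓ) →
      ψ (ℓ : ZMod f) ≠ 1 ∧ KrizLi2019.primVal (KrizLi2019.invMulOmega ψ ω) ℓ ≠ 1)
    (εK : DirichletCharacter ℚ_[p] (NumberField.discr K).natAbs) (hεK : KrizLi2019.IsKroneckerCharacterOf K εK)
    (h4 : ¬ (‖KrizLi2019.bernoulliOnePrim (KrizLi2019.bernoulliCharOne ψ εK) *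
        KrizLi2019.bernoulliOnePrim (KrizLi2019.bernoulliCharTwo ψ εK ω)‖ ≤ (p : ℝ)⁻¹)) :
    LDerivEK W K ≠ 0 :=
  (lDerivEK_ne_zero_iff_not_isOfFinAddOrder W N K hGZ hK hHH ⟨Dt, H, ι, hP⟩).mpr
    (not_isOfFinAddOrder_of_thm120 hKL hp2 W h2 N K Dt H ι P hN hK hHH hpN hP f ψ ω hψ hω hss h1 h1' h3 εK hεK h4)

/-- **Kriz–Li Thm. 1.20 + Gross–Zagier + modularity ⟹ `r_an(W) + r_an(W^{(d_K)}) ≤ 1`** at a Heegner datum as in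
`not_isOfFinAddOrder_of_thm120`: `L'(W/K, 1) ≠ 0` (`lDerivEK_ne_zero_of_thm120`), and `L(W/K, s) = L(W, s)·L(W^{(d_K)}, s)`
cannot have a non-zero derivative at `1` if one factor vanishes to order `≥ 2` or both vanish (product rule,
`ShimuraKolyvaginTransport.analyticRank_add_le_one_of_LDerivEK_ne_zero`; differentiability from modularity `hmod`). This is the
printed «`E/K` has analytic … rank 1» read over `ℚ`. CONDITIONAL on `hKL`, `hGZ`, `hmod`. [cite: KrizLi2019, Thm. 1.20 (p. 8)]
[cite: IrelandRosen1990, Prop. 20.5.4(b)] [cite: BCDTJAMS2001, Theorem A] -/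
theorem analyticRank_add_twist_le_one_of_thm120 (hKL : KrizLi2019.thm120_padicLogHeegner_unit_of_bernoulli) (hp2 : p ≠ 2)
    (hmod : hasEntireLFunction_rat)
    (W : WeierstrassCurve ℚ) [W.IsElliptic] [W.IsGloballyMinimal]
    (h2 : ∀ ℓ : ℕ, (hℓ : ℓ.Prime) → ¬ (haveI := Fact.mk hℓ; W.HasSplitMultiplicativeReductionAtPrime ℓ))
    (N : ℕ) [NeZero N] (K : Type) [Field K] [NumberField K] (hGZ : gross_zagier N W K)
    (Dt : ModularParametrizationData W N) (H : HeegnerDatum N (NumberField.discr K)) (ι : K →+* ℂ)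
    (P : (W.baseChange K).toAffine.Point) (hN : W.conductorNorm ℤ = N) (hK : IsImaginaryQuadratic K)
    (hHH : SatisfiesHeegnerHypothesis N K) (hpN : p ∣ N)
    (hP : WeierstrassCurve.Affine.Point.map ι.toRatAlgHom P = heegnerPointComplex Dt H)
    (f : ℕ) [NeZero f] (ψ : DirichletCharacter ℚ_[p] f) (ω : DirichletCharacter ℚ_[p] p)
    (hψ : ψ.IsPrimitive) (hω : KrizLi2019.IsTeichmullerCharacter ω)
    (hss : ∀ ℓ : ℕ, ℓ.Prime → ¬ (ℓ ∣ p * W.conductorNorm ℤ) →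
      ‖((W.LFunction ℓ : ℤ) : ℚ_[p]) - (ψ (ℓ : ZMod f) + ψ⁻¹ (ℓ : ZMod f) * ω (ℓ : ZMod p))‖ < 1)
    (h1 : ψ (p : ZMod f) ≠ 1) (h1' : KrizLi2019.primVal (KrizLi2019.invMulOmega ψ ω) p ≠ 1)
    (h3 : ∀ ℓ : ℕ, (hℓ : ℓ.Prime) → ℓ ≠ p →
      (haveI := Fact.mk hℓ; ¬ W.HasGoodReductionAtPrime ℓ ∧ ¬ W.HasMultiplicativeReductionAtPrime ℓ) →
      ψ (ℓ : ZMod f) ≠ 1 ∧ KrizLi2019.primVal (KrizLi2019.invMulOmega ψ ω) ℓ ≠ 1)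
    (εK : DirichletCharacter ℚ_[p] (NumberField.discr K).natAbs) (hεK : KrizLi2019.IsKroneckerCharacterOf K εK)
    (h4 : ¬ (‖KrizLi2019.bernoulliOnePrim (KrizLi2019.bernoulliCharOne ψ εK) *
        KrizLi2019.bernoulliOnePrim (KrizLi2019.bernoulliCharTwo ψ εK ω)‖ ≤ (p : ℝ)⁻¹)) :
    W.analyticRank + (W.quadraticTwist (NumberField.discr K : ℚ)).analyticRank ≤ 1 :=
  ShimuraKolyvaginTransport.analyticRank_add_le_one_of_LDerivEK_ne_zero W K hmod
    (lDerivEK_ne_zero_of_thm120 hKL hp2 W h2 N K hGZ Dt H ι P hN hK hHH hpN hP f ψ ω hψ hω hss h1 h1' h3 εK hεK h4)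

/-- **Kriz–Li Thm. 1.20 + Gross–Zagier + modularity + `r_an(W) = 1 ⟹ L(W^{(d_K)}, 1) ≠ 0`** at a Heegner datum as in
`not_isOfFinAddOrder_of_thm120`: `r_an(W) + r_an(W^{(d_K)}) ≤ 1` forces `r_an(W^{(d_K)}) = 0`, i.e. the central value of the
twist does not vanish (`analyticRank_eq_zero_iff_holds`). THIS IS THE CONJUNCT `hLt` OF THE LINE'S «KRIZ–LI DATUM», now a
consequence of the others. CONDITIONAL on `hKL`, `hGZ`, `hmod`. [cite: KrizLi2019, Thm. 1.20 (p. 8)]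
[cite: GrossZagier1986, Thm. I.(6.3) and V.§2] [cite: BCDTJAMS2001, Theorem A] -/
theorem entireLFunction_twist_one_ne_zero_of_thm120 (hKL : KrizLi2019.thm120_padicLogHeegner_unit_of_bernoulli)
    (hp2 : p ≠ 2) (hmod : hasEntireLFunction_rat)
    (W : WeierstrassCurve ℚ) [W.IsElliptic] [W.IsGloballyMinimal]
    (h2 : ∀ ℓ : ℕ, (hℓ : ℓ.Prime) → ¬ (haveI := Fact.mk hℓ; W.HasSplitMultiplicativeReductionAtPrime ℓ))
    (hr : W.analyticRank = 1)
    (N : ℕ) [NeZero N] (K : Type) [Field K] [NumberField K] (hGZ : gross_zagier N W K)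
    (Dt : ModularParametrizationData W N) (H : HeegnerDatum N (NumberField.discr K)) (ι : K →+* ℂ)
    (P : (W.baseChange K).toAffine.Point) (hN : W.conductorNorm ℤ = N) (hK : IsImaginaryQuadratic K)
    (hHH : SatisfiesHeegnerHypothesis N K) (hpN : p ∣ N)
    (hP : WeierstrassCurve.Affine.Point.map ι.toRatAlgHom P = heegnerPointComplex Dt H)
    (f : ℕ) [NeZero f] (ψ : DirichletCharacter ℚ_[p] f) (ω : DirichletCharacter ℚ_[p] p)
    (hψ : ψ.IsPrimitive) (hω : KrizLi2019.IsTeichmullerCharacter ω)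
    (hss : ∀ ℓ : ℕ, ℓ.Prime → ¬ (ℓ ∣ p * W.conductorNorm ℤ) →
      ‖((W.LFunction ℓ : ℤ) : ℚ_[p]) - (ψ (ℓ : ZMod f) + ψ⁻¹ (ℓ : ZMod f) * ω (ℓ : ZMod p))‖ < 1)
    (h1 : ψ (p : ZMod f) ≠ 1) (h1' : KrizLi2019.primVal (KrizLi2019.invMulOmega ψ ω) p ≠ 1)
    (h3 : ∀ ℓ : ℕ, (hℓ : ℓ.Prime) → ℓ ≠ p →
      (haveI := Fact.mk hℓ; ¬ W.HasGoodReductionAtPrime ℓ ∧ ¬ W.HasMultiplicativeReductionAtPrime ℓ) →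
      ψ (ℓ : ZMod f) ≠ 1 ∧ KrizLi2019.primVal (KrizLi2019.invMulOmega ψ ω) ℓ ≠ 1)
    (εK : DirichletCharacter ℚ_[p] (NumberField.discr K).natAbs) (hεK : KrizLi2019.IsKroneckerCharacterOf K εK)
    (h4 : ¬ (‖KrizLi2019.bernoulliOnePrim (KrizLi2019.bernoulliCharOne ψ εK) *
        KrizLi2019.bernoulliOnePrim (KrizLi2019.bernoulliCharTwo ψ εK ω)‖ ≤ (p : ℝ)⁻¹)) :
    (W.quadraticTwist (NumberField.discr K : ℚ)).entireLFunction 1 ≠ 0 := by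
  have hd : (NumberField.discr K : ℚ) ≠ 0 := by exact_mod_cast NumberField.discr_ne_zero K
  haveI := W.isElliptic_quadraticTwist hd
  have h := analyticRank_add_twist_le_one_of_thm120 hKL hp2 hmod W h2 N K hGZ Dt H ι P hN hK hHH hpN hP f ψ ω hψ hω hss
    h1 h1' h3 εK hεK h4
  have h0 : (W.quadraticTwist (NumberField.discr K : ℚ)).analyticRank = 0 := by omega
  exact ((W.quadraticTwist (NumberField.discr K : ℚ)).analyticRank_eq_zero_iff_holds (hmod _)).mp h0

end Datum

/-! ## §3 On the CM-ramified class: `h2` and `p ∣ N_W` are automatic -/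

section CMRamified

variable {p : ℕ} [Fact p.Prime]

/-- **On the CM-ramified class the twist `L`-value is automatic.** For `W/ℚ` globally minimal with CM, `p ≥ 5` CM-ramified,
`r_an(W) = 1`, and the binders of the line's Kriz–Li datum WITHOUT `hLt` — a Heegner field `K''` of `N_W` with Heegner point
`P`, Kriz–Li's character data `(ψ, ω)` with (1), (3) and the trace form, `ε_{K''}` and (4) —: `L(W^{(d_{K''})}, 1) ≠ 0`.
Kriz–Li's (2) is vacuous for CM (`RouteU.not_hasSplitMultiplicativeReductionAtPrime_of_hasCM`); `p ∣ N_W` because `W` is additive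
at `p` (`addv_of_cmRamified`). CONDITIONAL on `hKL` and `ToricPublishedInputs` (its Gross–Zagier and modularity conjuncts).
[cite: KrizLi2019, Thm. 1.20 (pp. 7–8) and Rem. 1.21 (p. 8)] [cite: GrossZagier1986, Thm. I.(6.3) and V.§2] -/
theorem entireLFunction_twist_one_ne_zero_cmRamified_of_thm120
    (hKL : KrizLi2019.thm120_padicLogHeegner_unit_of_bernoulli) (hF : ToricPublishedInputs)
    (W : WeierstrassCurve ℚ) [W.IsElliptic] [W.IsGloballyMinimal] (hCM : W.HasCM) (hram : CMRamified W p) (h5 : 5 ≤ p)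
    (hr : W.analyticRank = 1)
    (N : ℕ) [NeZero N] (K : Type) [Field K] [NumberField K]
    (Dt : ModularParametrizationData W N) (H : HeegnerDatum N (NumberField.discr K)) (ι : K →+* ℂ)
    (P : (W.baseChange K).toAffine.Point) (hN : W.conductorNorm ℤ = N) (hK : IsImaginaryQuadratic K)
    (hHN : SatisfiesHeegnerHypothesis N K)
    (hP : WeierstrassCurve.Affine.Point.map ι.toRatAlgHom P = heegnerPointComplex Dt H)
    (f : ℕ) [NeZero f] (ψ : DirichletCharacter ℚ_[p] f) (ω : DirichletCharacter ℚ_[p] p)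
    (hψ : ψ.IsPrimitive) (hω : KrizLi2019.IsTeichmullerCharacter ω)
    (hss : ∀ ℓ : ℕ, ℓ.Prime → ¬ (ℓ ∣ p * W.conductorNorm ℤ) →
      ‖((W.LFunction ℓ : ℤ) : ℚ_[p]) - (ψ (ℓ : ZMod f) + ψ⁻¹ (ℓ : ZMod f) * ω (ℓ : ZMod p))‖ < 1)
    (h1 : ψ (p : ZMod f) ≠ 1) (h1' : KrizLi2019.primVal (KrizLi2019.invMulOmega ψ ω) p ≠ 1)
    (h3 : ∀ ℓ : ℕ, (hℓ : ℓ.Prime) → ℓ ≠ p →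
      (haveI := Fact.mk hℓ; ¬ W.HasGoodReductionAtPrime ℓ ∧ ¬ W.HasMultiplicativeReductionAtPrime ℓ) →
      ψ (ℓ : ZMod f) ≠ 1 ∧ KrizLi2019.primVal (KrizLi2019.invMulOmega ψ ω) ℓ ≠ 1)
    (εK : DirichletCharacter ℚ_[p] (NumberField.discr K).natAbs) (hεK : KrizLi2019.IsKroneckerCharacterOf K εK)
    (h4 : ¬ (‖KrizLi2019.bernoulliOnePrim (KrizLi2019.bernoulliCharOne ψ εK) *
        KrizLi2019.bernoulliOnePrim (KrizLi2019.bernoulliCharTwo ψ εK ω)‖ ≤ (p : ℝ)⁻¹)) :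
    (W.quadraticTwist (NumberField.discr K : ℚ)).entireLFunction 1 ≠ 0 := by
  obtain ⟨hGZ, -, -, hmod, -⟩ := id hF
  have hp2 : p ≠ 2 := by omega
  have hadd : Addv W p := EisensteinResourceBdpLine.addv_of_cmRamified W hCM hram h5
  have hpN : p ∣ N := by
    rw [← hN]; exact (W.dvd_conductorNorm_iff_not_hasGoodReductionAtPrime p).mpr hadd.1
  exact entireLFunction_twist_one_ne_zero_of_thm120 hKL hp2 hmod W
    (X12.O11.RouteU.not_hasSplitMultiplicativeReductionAtPrime_of_hasCM W hCM) hr N K (hGZ N W K) Dt H ι P hN hK hHN hpN hP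
    f ψ ω hψ hω hss h1 h1' h3 εK hεK h4

/-- **The Heegner point of a Kriz–Li datum on the class is not torsion** (class form of `not_isOfFinAddOrder_of_thm120`: (2)
and `p ∣ N_W` discharged). CONDITIONAL on `hKL`. [cite: KrizLi2019, Thm. 1.20 (p. 8) and Rem. 1.21] -/
theorem not_isOfFinAddOrder_cmRamified_of_thm120
    (hKL : KrizLi2019.thm120_padicLogHeegner_unit_of_bernoulli)
    (W : WeierstrassCurve ℚ) [W.IsElliptic] [W.IsGloballyMinimal] (hCM : W.HasCM) (hram : CMRamified W p) (h5 : 5 ≤ p)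
    (N : ℕ) [NeZero N] (K : Type) [Field K] [NumberField K]
    (Dt : ModularParametrizationData W N) (H : HeegnerDatum N (NumberField.discr K)) (ι : K →+* ℂ)
    (P : (W.baseChange K).toAffine.Point) (hN : W.conductorNorm ℤ = N) (hK : IsImaginaryQuadratic K)
    (hHN : SatisfiesHeegnerHypothesis N K)
    (hP : WeierstrassCurve.Affine.Point.map ι.toRatAlgHom P = heegnerPointComplex Dt H)
    (f : ℕ) [NeZero f] (ψ : DirichletCharacter ℚ_[p] f) (ω : DirichletCharacter ℚ_[p] p)
    (hψ : ψ.IsPrimitive) (hω : KrizLi2019.IsTeichmullerCharacter ω)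
    (hss : ∀ ℓ : ℕ, ℓ.Prime → ¬ (ℓ ∣ p * W.conductorNorm ℤ) →
      ‖((W.LFunction ℓ : ℤ) : ℚ_[p]) - (ψ (ℓ : ZMod f) + ψ⁻¹ (ℓ : ZMod f) * ω (ℓ : ZMod p))‖ < 1)
    (h1 : ψ (p : ZMod f) ≠ 1) (h1' : KrizLi2019.primVal (KrizLi2019.invMulOmega ψ ω) p ≠ 1)
    (h3 : ∀ ℓ : ℕ, (hℓ : ℓ.Prime) → ℓ ≠ p →
      (haveI := Fact.mk hℓ; ¬ W.HasGoodReductionAtPrime ℓ ∧ ¬ W.HasMultiplicativeReductionAtPrime ℓ) →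
      ψ (ℓ : ZMod f) ≠ 1 ∧ KrizLi2019.primVal (KrizLi2019.invMulOmega ψ ω) ℓ ≠ 1)
    (εK : DirichletCharacter ℚ_[p] (NumberField.discr K).natAbs) (hεK : KrizLi2019.IsKroneckerCharacterOf K εK)
    (h4 : ¬ (‖KrizLi2019.bernoulliOnePrim (KrizLi2019.bernoulliCharOne ψ εK) *
        KrizLi2019.bernoulliOnePrim (KrizLi2019.bernoulliCharTwo ψ εK ω)‖ ≤ (p : ℝ)⁻¹)) :
    ¬ IsOfFinAddOrder P := by
  have hp2 : p ≠ 2 := by omega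
  have hadd : Addv W p := EisensteinResourceBdpLine.addv_of_cmRamified W hCM hram h5
  have hpN : p ∣ N := by
    rw [← hN]; exact (W.dvd_conductorNorm_iff_not_hasGoodReductionAtPrime p).mpr hadd.1
  exact not_isOfFinAddOrder_of_thm120 hKL hp2 W (X12.O11.RouteU.not_hasSplitMultiplicativeReductionAtPrime_of_hasCM W hCM)
    N K Dt H ι P hN hK hHN hpN hP f ψ ω hψ hω hss h1 h1' h3 εK hεK h4

end CMRamified

end Summit.BirchSwinnertonDyer.BirchSwinnertonDyer.Theorems.PrintCFram.KrizLiLValueFree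

end
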